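/- Free-seat work of EXTRA WIDTH SEAT `ym-line-cbag-p1-w5` (prover-ym-line-cbag-p1-w5-g2-0), route `EguchiKawaiDirectionLadder`
(ideator ym-idea-2, LINE 8), crux `TripleSmallBallMargin` (stmt-QuantumFields-27724), LEAD g24's v7 architecture, glue for STUB S7 (E_rob),
the «Cauchy interlacing» step of the fixed-projection column engine, proved WITHOUT min–max: by Cauchy–Binet (tree:
`GramDeterminantKernel.sum_det_submatrix_mul_det_submatrix`) the determinant of a compression `P⋆ diag(d) P` (`P` an `n × q` isometry) is a
CONVEX COMBINATION of the products `∏_{i} d_{τ(i)}` over injective `τ : Fin q → Fin n` (weights `|det P_τ|²/q!`), hence at least the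
smallest such product («drop the `n − q` largest weights»).  Engine-facing form: `Re det(1 + b⁻¹ · diag(m)⋆ (V P₀ V⋆) diag(m)) ≥ m₀` whenever
`m₀ ≤ ∏_i (1 + |m_{τ(i)}|²/b)` for all injective `τ` — the input of `stdGaussian_measure_quadForm_le` (w3) for the rank-robust rigidity
(S7) after `LowRankKill` + the Grassmannian net (S6).  Deterministic, route-independent.  Nothing here bears on the Yang–Mills mass gap. -/
import Literature.LinearAlgebra.Matrix.GramDeterminantKernel
import Summits.QuantumFields.YangMills.Theorems.EguchiKawaiDirectionLadderGrassmannianNetGrid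

/-!
# Route `EguchiKawaiDirectionLadder`, glue for S7: determinants of compressions by Cauchy–Binet («interlacing without min–max»)

* `factorial_mul_det_isometry_compression` — for `P : n × q` with `P⋆ P = 1` and real `d`:
  `q! · det(P⋆ diag(d) P) = Σ_{τ : Fin q → Fin n} (∏_i d_{τ i}) · |det P[τ, ·]|²`, and `Σ_τ |det P[τ,·]|² = q!`;
* `re_det_isometry_compression_ge` — hence `Re det(P⋆ diag(d) P) ≥ m₀` whenever `m₀ ≤ ∏_i d_{τ i}` for every INJECTIVE `τ`
  (non-injective `τ` have `det P[τ,·] = 0`);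
* head columns: `P := V[·, head] : (r+s) × r` satisfies `P⋆P = 1`, `P P⋆ = V·headProj r s·V⋆`;
* `re_det_one_add_smul_conjProj_ge` — ENGINE FORM: for `V ∈ U(r+s)`, `m : Fin (r+s) → ℂ`, `b > 0`,
  `Re det(1 + b⁻¹ • (diag(m)⋆ · (V·headProj·V⋆) · diag(m))) ≥ m₀` whenever `m₀ ≤ ∏_{i<r} (1 + |m_{τ i}|²/b)` for all injective
  `τ : Fin r → Fin (r+s)` (Sylvester `det(1 + AB) = det(1 + BA)` + the above with `P = V[·, head]`).
-/

set_option autoImplicit false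

noncomputable section

open scoped Matrix
open Literature.Barriers.QuantumFields

namespace Summit.QuantumFields.YangMills.Theorems.EguchiKawaiDirectionLadder

namespace GrNet

/-! ### Compressions of diagonal matrices by isometries: Cauchy–Binet -/

section Compression

variable {n q : ℕ}

/-- Rows selected by a non-injective map repeat, so the minor vanishes. -/
theorem det_submatrix_eq_zero_of_not_injective (P : Matrix (Fin n) (Fin q) ℂ) {τ : Fin q → Fin n}
    (hτ : ¬ Function.Injective τ) : (P.submatrix τ id).det = 0 := by
  obtain ⟨i, j, hij, hne⟩ : ∃ i j, τ i = τ j ∧ i ≠ j := by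
    rw [Function.Injective] at hτ; push Not at hτ
    obtain ⟨i, j, h, hne⟩ := hτ; exact ⟨i, j, h, hne⟩
  exact Matrix.det_zero_of_row_eq hne (by ext k; simp [Matrix.submatrix_apply, hij])

/-- **Cauchy–Binet for a compression of a diagonal matrix**: `q! · det(P⋆ diag(d) P) = Σ_τ (∏_i d_{τ i}) · |det P[τ,·]|²`. -/
theorem factorial_mul_det_isometry_compression (P : Matrix (Fin n) (Fin q) ℂ) (d : Fin n → ℝ) :
    ((q.factorial : ℕ) : ℂ) * (Pᴴ * Matrix.diagonal (fun j => ((d j : ℝ) : ℂ)) * P).det =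
      ∑ τ : Fin q → Fin n, (((∏ i, d (τ i) : ℝ)) : ℂ) * (‖(P.submatrix τ id).det‖ ^ 2 : ℝ) := by
  have h := Literature.LinearAlgebra.Matrix.sum_det_submatrix_mul_det_submatrix Pᴴ
    (Matrix.diagonal (fun j => ((d j : ℝ) : ℂ)) * P)
  rw [Fintype.card_fin] at h
  rw [Matrix.mul_assoc, ← h]
  refine Finset.sum_congr rfl fun τ _ => ?_
  -- `(P⋆)[·, τ] = (P[τ, ·])⋆` and `(diag d · P)[τ, ·] = diag(d ∘ τ) · P[τ, ·]`
  have h1 : Pᴴ.submatrix id τ = (P.submatrix τ id)ᴴ := by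
    rw [Matrix.conjTranspose_submatrix]
  have h2 : (Matrix.diagonal (fun j => ((d j : ℝ) : ℂ)) * P).submatrix τ id =
      Matrix.diagonal (fun i => ((d (τ i) : ℝ) : ℂ)) * P.submatrix τ id := by
    ext i k
    simp [Matrix.submatrix_apply, Matrix.diagonal_mul]
  rw [h1, h2, Matrix.det_conjTranspose, Matrix.det_mul, Matrix.det_diagonal]
  set z : ℂ := (P.submatrix τ id).det
  have hz : star z * z = ((‖z‖ ^ 2 : ℝ) : ℂ) := by
    rw [Complex.star_def, mul_comm, Complex.mul_conj, Complex.normSq_eq_norm_sq]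
  calc star z * ((∏ i, ((d (τ i) : ℝ) : ℂ)) * z) = (∏ i, ((d (τ i) : ℝ) : ℂ)) * (star z * z) := by ring
    _ = _ := by rw [hz]; push_cast; ring

/-- The weights sum to `q!`: `Σ_τ |det P[τ,·]|² = q!` for an isometry `P⋆P = 1`. -/
theorem sum_norm_sq_det_submatrix (P : Matrix (Fin n) (Fin q) ℂ) (hP : Pᴴ * P = 1) :
    ∑ τ : Fin q → Fin n, (‖(P.submatrix τ id).det‖ ^ 2 : ℝ) = (q.factorial : ℝ) := by
  have h := factorial_mul_det_isometry_compression P (fun _ => 1)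
  have hdiag : Matrix.diagonal (fun _ : Fin n => (((1 : ℝ) : ℝ) : ℂ)) = 1 := by
    rw [Complex.ofReal_one, Matrix.diagonal_one]
  rw [hdiag, Matrix.mul_one, hP, Matrix.det_one, mul_one] at h
  have h' : ((q.factorial : ℕ) : ℂ) = ((∑ τ : Fin q → Fin n, (‖(P.submatrix τ id).det‖ ^ 2 : ℝ) : ℝ) : ℂ) := by
    rw [h]; push_cast
    refine Finset.sum_congr rfl fun τ _ => ?_
    simp
  exact_mod_cast h'.symm

/-- **Interlacing without min–max**: for an isometry `P` (`P⋆P = 1`) and real weights `d`, if `m₀ ≤ ∏_i d_{τ i}` for every injective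
`τ : Fin q → Fin n`, then `m₀ ≤ Re det(P⋆ diag(d) P)` — the determinant of the compression is a convex combination of those
products. -/
theorem re_det_isometry_compression_ge (P : Matrix (Fin n) (Fin q) ℂ) (hP : Pᴴ * P = 1) (d : Fin n → ℝ) {m₀ : ℝ}
    (hm : ∀ τ : Fin q → Fin n, Function.Injective τ → m₀ ≤ ∏ i, d (τ i)) :
    m₀ ≤ ((Pᴴ * Matrix.diagonal (fun j => ((d j : ℝ) : ℂ)) * P).det).re := by
  have hfac : (0 : ℝ) < (q.factorial : ℝ) := by exact_mod_cast Nat.factorial_pos q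
  have h := factorial_mul_det_isometry_compression P d
  have hsum := sum_norm_sq_det_submatrix P hP
  -- real parts
  have hre : (q.factorial : ℝ) * ((Pᴴ * Matrix.diagonal (fun j => ((d j : ℝ) : ℂ)) * P).det).re =
      ∑ τ : Fin q → Fin n, (∏ i, d (τ i)) * ‖(P.submatrix τ id).det‖ ^ 2 := by
    have := congrArg Complex.re h
    rw [Complex.re_sum] at this
    simp only [Complex.mul_re, Complex.natCast_re, Complex.natCast_im, zero_mul, sub_zero,
      Complex.ofReal_re, Complex.ofReal_im] at this
    rw [this]
  -- termwise: (∏ d) · w_τ ≥ m₀ · w_τ (w_τ = 0 unless τ injective)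
  have hterm : ∀ τ : Fin q → Fin n, m₀ * ‖(P.submatrix τ id).det‖ ^ 2 ≤ (∏ i, d (τ i)) * ‖(P.submatrix τ id).det‖ ^ 2 := by
    intro τ
    by_cases hτ : Function.Injective τ
    · exact mul_le_mul_of_nonneg_right (hm τ hτ) (sq_nonneg _)
    · rw [det_submatrix_eq_zero_of_not_injective P hτ, norm_zero]; simp
  have hge : m₀ * (q.factorial : ℝ) ≤ (q.factorial : ℝ) * ((Pᴴ * Matrix.diagonal (fun j => ((d j : ℝ) : ℂ)) * P).det).re := by
    rw [hre, ← hsum, Finset.mul_sum]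
    exact Finset.sum_le_sum fun τ _ => hterm τ
  nlinarith

end Compression

/-! ### The head columns of a unitary and the engine form -/

section Head

variable {r s : ℕ}

/-- The first `r` columns `P = V[·, head]` of a unitary form an isometry: `P⋆ P = 1`. -/
theorem headCols_isometry (V : Matrix.unitaryGroup (Fin (r + s)) ℂ) :
    ((V : Matrix (Fin (r + s)) (Fin (r + s)) ℂ).submatrix id (Fin.castAdd s))ᴴ *
        (V : Matrix (Fin (r + s)) (Fin (r + s)) ℂ).submatrix id (Fin.castAdd s) = 1 := by
  rw [Matrix.conjTranspose_submatrix, ← Matrix.submatrix_mul _ _ _ id _ Function.bijective_id,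
    ← Matrix.star_eq_conjTranspose, Matrix.UnitaryGroup.star_mul_self]
  exact Matrix.submatrix_one _ (Fin.castAdd_injective _ _)

/-- `P P⋆ = V · headProj · V⋆` for `P = V[·, head]`. -/
theorem headCols_mul_conjTranspose (V : Matrix.unitaryGroup (Fin (r + s)) ℂ) :
    (V : Matrix (Fin (r + s)) (Fin (r + s)) ℂ).submatrix id (Fin.castAdd s) *
        ((V : Matrix (Fin (r + s)) (Fin (r + s)) ℂ).submatrix id (Fin.castAdd s))ᴴ =
      (V : Matrix (Fin (r + s)) (Fin (r + s)) ℂ) * headProj r s * (V : Matrix (Fin (r + s)) (Fin (r + s)) ℂ)ᴴ := by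
  ext a b
  rw [headProj_eq_diagonal, Matrix.mul_assoc, Matrix.mul_apply, Matrix.mul_apply, Fin.sum_univ_add]
  simp only [Matrix.diagonal_mul, Matrix.conjTranspose_apply, Matrix.submatrix_apply, id,
    finSumFinEquiv_symm_apply_castAdd, finSumFinEquiv_symm_apply_natAdd, Sum.elim_inl, Sum.elim_inr, one_mul,
    zero_mul, mul_zero, Finset.sum_const_zero, add_zero]

/-- **Engine form of the interlacing bound** (input of `stdGaussian_measure_quadForm_le` for the rank-robust rigidity S7): for
`V ∈ U(r+s)`, `m : Fin (r+s) → ℂ`, `b > 0`, and `m₀ ≤ ∏_i (1 + |m_{τ i}|²/b)` for every injective `τ : Fin r → Fin (r+s)`: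
`m₀ ≤ Re det(1 + b⁻¹ • (diag(m)⋆ · (V·headProj·V⋆) · diag(m)))` — the quadratic form of `‖P₀ V⋆ diag(m) g‖²` loses at most the `s`
LARGEST weights. -/
theorem re_det_one_add_smul_conjProj_ge (V : Matrix.unitaryGroup (Fin (r + s)) ℂ) (m : Fin (r + s) → ℂ) {b : ℝ} (hb : 0 < b)
    {m₀ : ℝ} (hm : ∀ τ : Fin r → Fin (r + s), Function.Injective τ → m₀ ≤ ∏ i, (1 + ‖m (τ i)‖ ^ 2 / b)) :
    m₀ ≤ ((1 + ((b⁻¹ : ℝ) : ℂ) • ((Matrix.diagonal m)ᴴ *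
      ((V : Matrix (Fin (r + s)) (Fin (r + s)) ℂ) * headProj r s * (V : Matrix (Fin (r + s)) (Fin (r + s)) ℂ)ᴴ) *
        Matrix.diagonal m)).det).re := by
  have _hb := hb
  set P : Matrix (Fin (r + s)) (Fin r) ℂ := (V : Matrix (Fin (r + s)) (Fin (r + s)) ℂ).submatrix id (Fin.castAdd s) with hPdef
  have hP : Pᴴ * P = 1 := headCols_isometry V
  rw [← headCols_mul_conjTranspose V]
  set D : Matrix (Fin (r + s)) (Fin (r + s)) ℂ := Matrix.diagonal m with hD
  -- Sylvester: det(1 + (c • Dᴴ P) (Pᴴ D)) = det(1 + (Pᴴ D)(c • Dᴴ P))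
  have hsylv : (1 + ((b⁻¹ : ℝ) : ℂ) • (Dᴴ * (P * Pᴴ) * D)).det = (1 + (Pᴴ * D) * (((b⁻¹ : ℝ) : ℂ) • (Dᴴ * P))).det := by
    have : ((b⁻¹ : ℝ) : ℂ) • (Dᴴ * (P * Pᴴ) * D) = (((b⁻¹ : ℝ) : ℂ) • (Dᴴ * P)) * (Pᴴ * D) := by
      rw [Matrix.smul_mul]; simp only [Matrix.mul_assoc]
    rw [this, Matrix.det_one_add_mul_comm]
  -- `D Dᴴ = diag(|m|²)` and `diag(1 + |m|²/b) = 1 + b⁻¹ • D Dᴴ`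
  have hDD : D * Dᴴ = Matrix.diagonal (fun j => (((‖m j‖ ^ 2 : ℝ)) : ℂ)) := by
    rw [hD, Matrix.diagonal_conjTranspose, Matrix.diagonal_mul_diagonal]
    congr 1; funext j
    rw [Pi.star_apply, Complex.star_def, Complex.mul_conj, Complex.normSq_eq_norm_sq]
  have hdiag : Matrix.diagonal (fun j => (((1 + ‖m j‖ ^ 2 / b : ℝ)) : ℂ)) = 1 + ((b⁻¹ : ℝ) : ℂ) • (D * Dᴴ) := by
    rw [hDD]
    ext i j
    by_cases hij : i = j
    · subst hij
      simp [Matrix.diagonal_apply_eq, Matrix.one_apply_eq]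
      ring
    · simp [Matrix.diagonal_apply_ne _ hij, Matrix.one_apply_ne hij]
  have hcomp : 1 + (Pᴴ * D) * (((b⁻¹ : ℝ) : ℂ) • (Dᴴ * P)) =
      Pᴴ * Matrix.diagonal (fun j => (((1 + ‖m j‖ ^ 2 / b : ℝ)) : ℂ)) * P := by
    rw [hdiag, Matrix.mul_add, Matrix.mul_one, Matrix.add_mul, hP]
    simp only [Matrix.mul_smul, Matrix.smul_mul, Matrix.mul_assoc]
  rw [hsylv, hcomp]
  exact re_det_isometry_compression_ge P hP (fun j => 1 + ‖m j‖ ^ 2 / b) hm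

end Head

end GrNet

end Summit.QuantumFields.YangMills.Theorems.EguchiKawaiDirectionLadder

end
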